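import Literature.MathematicalPhysics.QuantumFieldTheory.Balaban1983to89.B9SmoothHolderClassPReadings

/-!
# `Balaban1983to89.B9SmoothHolderClassPReadingsSite` — the class axiom `hX` READ at the print-weighted SITE pin (P2′) `bH13 := bHZPG (taxiS U) w13`: the identity map from
# the (graded, transported, print-weighted) smooth Hölder class of the SITE coordinate carrier into the sharp `(Lʲη)^{−1}`-weighted sup class `𝔠_W⁽¹⁾ = cNorm … (blkSK (sIK bI)) 1`
# — the site twins of `B9SmoothHolderClassTReadings.hasMaj_id_bHZKT_cNorm` ∕ `B9SmoothHolderClassPReadings.hasMaj_id_bHZKP(G)_cNorm`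

T. Bałaban, *Propagators for lattice gauge theories in a background field*, Commun. Math. Phys. **99** (1985) 389–434
[`Balaban1985BackgroundPropagators`, "B9"]; [4] = T. Bałaban, *Propagators and renormalization transformations for lattice gauge
theories. II*, Commun. Math. Phys. **96** (1984) 223–250 [`Balaban1984PropagatorsII`].

statement-level skeleton of published theorems with citation tags; proofs where landed; nothing here is a claim about the
Yang–Mills mass gap

THE PRINTED LOCI.  [B9] (3.41)–(3.42) p. 397, (3.43)–(3.45) p. 398 (*"supp λ ⊂ Δ̃(y′)"*, *"(‖λ‖ + |λ|)"* — a Hölder-class norm contains the sup); [4] (2.51)–(2.54) p. 232.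

WHY THIS FILE (cell `pub-ymgap`, node N06, seat dag-n06-d g18; FLAG №8 (U8) STEP 2b).  The perturbation step over the regular state class
(`B9Thm312WholeStepRegular.stepS_of_lettersS`) composes the state letters `T_b, T_b₂ : 𝔖₂ → bH13 x U` (dag-n06-d `hLettersS_of_pinsP44_geo9Y`) with a producer `G₀D_U : bH13 x U → 𝔖₂`;
the tree's producer (`hStateFacts_of_pinsP_geo9Y`, from (3.42)₃ + (3.43)) reads the W-SUP class `cNorm … (𝔬12 x).blkW … 1`.  The missing link is the reading
`id : bH13 x U → 𝔠_W⁽¹⁾` — only the SUP part of the site Hölder class is read.  The bond twins are landed (`hasMaj_id_bHZKT_cNorm`, `hasMaj_id_bHZKPG_cNorm`); the untransported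
site reading is `B9SmoothHolderClassSReadings.hasMaj_id_bHZ_cNorm`.  HERE: ★★ `hasMaj_id_bHZT_cNorm` — for every site transporter table `g` and `0 ≤ ε ≤ 1 ≤ p` (`ε ≤ p`) the
identity `bHZT g ε p → cNorm (blkSK (sIK bI)) 1` has majorant `L·e^{δr}·e^{−δd}` (proof = the `bHZ` proof verbatim: a vector localised at `y′` vanishes off `Δ̃(y′)`; a block
carrying a nonzero value holds a site of `Δ̃(y′)`, so `d ≤ r` (LAYER B) and `j(y) ≥ j(y′) − 1`); ★ `hasMaj_id_bHZP_cNorm` (print-weighted, `0 ≤ s ≤ 1`); ★★ `hasMaj_id_bHZPG_cNorm`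
(graded, any exponent `0 < s < 1` with `0 < w s`: constant `(w s)⁻¹·L·e^{δr}`).
HONEST SCOPE.  Bookkeeping over landed definitions; the radius `r` displayed (LAYER B discharges it); nothing of [B9]∕[4] asserted; no certificate edit; COUNT-NEUTRAL;
N06 NOT discharged; nothing continuum, nothing about the mass gap.  Cell `pub-ymgap` (HUMAN RULING D-0062), Track A node N06 [B9], 2026-08-29.  NEW file; nothing landed is modified.
-/

noncomputable section

namespace Literature.MathematicalPhysics.QuantumFieldTheory.Balaban1983to89.B9SmoothHolderClassPReadingsSite

open B6Geom246MultiLevelTorus (bondT)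
open B6GlobalChartV1 (PV blkV1)
open B6Ineq2142KLevelV1 (β lvl)
open B6KLevelCensusIndexV1 (KIdx)
open B6Prop22KLevelTorusCensusEta (nKT one_le_nKT)
open B9GeoNormsKLevelV1 (geo9K)
open B9Thm34Ext (toB6)
open B11SectG (BlockNorm HasMaj)
open B11SectGGlobal (Size)
open B11SectGGlobalSizes
open B9Thm312Whole (cNorm wt)
open B9CoReadingCoordsS (XSK sIK blkSK sIK_level)
open B9MultiscaleSmoothPartitionY (scl scl_pos NearY levY_window_of_nearY levY_eq_blkOf)
open B9SmoothHolderClassS (Wscl Wscl_nonneg Wscl_mono NearPair wEta wEta_nonneg)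
open B9SmoothHolderClassT (bHZT bHZT_loc bHZT_isLoc_iff)
open B9SmoothHolderClassSReadings (wt_one_eq Wscl_one_eq ofBlocks_loc_le_ofSup ofBlocks_loc_eq_zero)
open B9SmoothHolderClassP (bHZP bHZPG hasMaj_from_bHZPG)
open B9SmoothHolderClassPReadings (hasMaj_from_bHZP_of_bHZT)
open Node00 (SiteY FBondY IBondY toKT levY)

variable {d ℓ : ℕ} {hd : 1 ≤ d + 1} {hL : Odd (ℓ + 1) ∧ 1 < ℓ + 1} {b₀ b₁ : ℝ}
variable {𝔸 : Type} [NormedRing 𝔸] [NormedAlgebra ℂ 𝔸]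
variable {κ : Type} [Fintype κ]
variable (i : KIdx d ℓ hd hL b₀ b₁) [Fintype (geo9K i).Site] (b : Module.Basis κ ℝ 𝔸) (g : SiteY i → SiteY i → 𝔸ˣ)

/-- ★★ **THE CLASS AXIOM `hX` AT A TRANSPORTED SITE CLASS**: for every transporter table `g` and `0 ≤ ε ≤ 1 ≤ p` (`ε ≤ p`), the identity map `bHZT g ε p → 𝔠_W⁽¹⁾ =
cNorm (blkSK (sIK bI)) 1` has the majorant `L·e^{δr}·e^{−δ·d(y,y′)}` for every `δ ≥ 0` — only the SUP part of the class is read (a site vector localised at `y′` vanishes off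
`Δ̃(y′)`; a block `y` carrying a nonzero value holds a site of `Δ̃(y′)`, whence `d(y,y′) ≤ r` — the displayed enlargement radius `hN`, discharged by LAYER B — and `j(y) ≥ j(y′) − 1`).
[cite: Balaban1985BackgroundPropagators, (3.41)–(3.42) p.397 + (3.44) p.398 + p.398 (remark after (3.47)); Balaban1984PropagatorsII, (2.51)–(2.54) p.232] -/
theorem hasMaj_id_bHZT_cNorm {R : ℝ} {H : Prop} {ε p : ℝ} (hε0 : 0 ≤ ε) (hε1 : ε ≤ 1) (hεp : ε ≤ p) (h1p : 1 ≤ p)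
    (hlen : ∀ y : (geo9K i).Site, 0 ≤ (geo9K i).len y) {bI : FBondY i → IBondY i}
    (hlev : ∀ f : FBondY i, lvl i.hN i.D i.hk (bI f) = (blkV1 i.hN i.D f).1.1)
    {r δ : ℝ} (hδ : 0 ≤ δ) (hN : ∀ (y : IBondY i) (z : SiteY i), NearY i y z → (geo9K i).dist y (sIK i bI z) ≤ r)
    (hcf : |i.cf| ≤ (nKT (toKT i) : ℝ)) :
    HasMaj (bHZT (κ := κ) i b g (R := R) (H := H) hε0 hε1 hεp) (cNorm R H (blkSK i (sIK i bI)) hlen 1) LinearMap.id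
      (fun y y' => (((ℓ + 1 : ℕ) : ℝ)) * Real.exp (δ * r) * Real.exp (-(δ * (geo9K i).dist y y'))) := by
  classical
  intro y' μ hμ y
  rw [bHZT_isLoc_iff] at hμ
  rw [LinearMap.id_apply]
  have hL0 : (0 : ℝ) ≤ ((ℓ + 1 : ℕ) : ℝ) := Nat.cast_nonneg _
  have hL1 : (1 : ℝ) ≤ ((ℓ + 1 : ℕ) : ℝ) := by exact_mod_cast Nat.succ_le_succ (Nat.zero_le ℓ)
  have hloc0 : 0 ≤ (bHZT (κ := κ) i b g (R := R) (H := H) hε0 hε1 hεp).loc y' μ := BlockNorm.loc_nonneg _ _ _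
  have hK0 : 0 ≤ (((ℓ + 1 : ℕ) : ℝ)) * Real.exp (δ * r) * Real.exp (-(δ * (geo9K i).dist y y')) := by positivity
  have hcN : (cNorm R H (blkSK i (sIK i bI)) hlen 1).loc y μ =
      wt (geo9K i) 1 y * (BlockNorm.ofBlocks (toB6 (geo9K i) R H) (blkSK i (sIK i bI))).loc y μ := rfl
  by_cases hex : ∃ q : XSK κ i, blkSK i (sIK i bI) q = y ∧ μ q ≠ 0
  · obtain ⟨q, hq, hμq⟩ := hex
    have hnear : NearY i y' q.1 := by by_contra hn; exact hμq (hμ q hn)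
    -- the block of `q` is `r`-close to `y′`
    have hdist : (geo9K i).dist y y' ≤ r := by
      have h := hN y' q.1 hnear
      have hsym : (geo9K i).dist y y' = (geo9K i).dist y' y := by
        show (((bondT i.D).dist _ _ : ℕ) : ℝ) = (((bondT i.D).dist _ _ : ℕ) : ℝ)
        rw [SimpleGraph.dist_comm]
      rw [hsym, ← hq]; exact h
    have hexp : 1 ≤ Real.exp (δ * r) * Real.exp (-(δ * (geo9K i).dist y y')) := by
      rw [← Real.exp_add]; exact Real.one_le_exp (by nlinarith)
    -- levels: `j(y) = lev q.1 ≥ j(y′) − 1`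
    have hly : lvl i.hN i.D i.hk y = levY i q.1 := by rw [← hq]; exact (sIK_level i hlev q.1).trans (levY_eq_blkOf i q.1).symm
    have hwin := (levY_window_of_nearY i hnear).1
    rw [← hly] at hwin
    -- weights: `wt 1 y ≤ L · Wscl p y′`
    have hs := scl_pos i y
    have hs' := scl_pos i y'
    have hscl : scl i y' ≤ ((ℓ + 1 : ℕ) : ℝ) * scl i y := by
      rw [scl, scl, ← pow_succ']; exact pow_le_pow_right₀ hL1 hwin
    have hwt : wt (geo9K i) 1 y ≤ ((ℓ + 1 : ℕ) : ℝ) * Wscl i p y' := by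
      have h1 : wt (geo9K i) 1 y ≤ ((ℓ + 1 : ℕ) : ℝ) * Wscl i 1 y' := by
        rw [wt_one_eq, Wscl_one_eq, mul_div_assoc', div_le_div_iff₀ hs hs']
        calc |i.cf| * scl i y' ≤ (nKT (toKT i) : ℝ) * (((ℓ + 1 : ℕ) : ℝ) * scl i y) :=
            mul_le_mul hcf hscl hs'.le (Nat.cast_nonneg _)
          _ = ((ℓ + 1 : ℕ) : ℝ) * (nKT (toKT i) : ℝ) * scl i y := by ring
      exact h1.trans (mul_le_mul_of_nonneg_left (Wscl_mono i h1p y') hL0)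
    -- the sharp sup against the `Δ̃(y′)`-sup, the latter against `loc^{bHZT}`
    have hsup := ofBlocks_loc_le_ofSup i (R := R) (H := H) (blkSK (κ := κ) i (sIK i bI)) hμ y
    have hbT : Wscl i p y' * (Size.ofSup (toB6 (geo9K i) R H) (fun (q : XSK κ i) (y : IBondY i) => NearY i y q.1)).sz y' μ ≤
        (bHZT (κ := κ) i b g (R := R) (H := H) hε0 hε1 hεp).loc y' μ := by
      rw [bHZT_loc]; exact le_add_of_nonneg_right (Size.nonneg _ _ _)
    calc (cNorm R H (blkSK i (sIK i bI)) hlen 1).loc y μ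
        = wt (geo9K i) 1 y * (BlockNorm.ofBlocks (toB6 (geo9K i) R H) (blkSK i (sIK i bI))).loc y μ := hcN
      _ ≤ (((ℓ + 1 : ℕ) : ℝ) * Wscl i p y') *
            (Size.ofSup (toB6 (geo9K i) R H) (fun (q : XSK κ i) (y : IBondY i) => NearY i y q.1)).sz y' μ :=
          mul_le_mul hwt hsup (BlockNorm.loc_nonneg _ _ _) (mul_nonneg hL0 (Wscl_nonneg i p y'))
      _ ≤ ((ℓ + 1 : ℕ) : ℝ) * (bHZT (κ := κ) i b g (R := R) (H := H) hε0 hε1 hεp).loc y' μ := by rw [mul_assoc]; exact mul_le_mul_of_nonneg_left hbT hL0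
      _ ≤ ((ℓ + 1 : ℕ) : ℝ) * (Real.exp (δ * r) * Real.exp (-(δ * (geo9K i).dist y y'))) * (bHZT (κ := κ) i b g (R := R) (H := H) hε0 hε1 hεp).loc y' μ := by
          rw [mul_assoc (((ℓ + 1 : ℕ) : ℝ))]
          exact mul_le_mul_of_nonneg_left (le_mul_of_one_le_left hloc0 hexp) hL0
      _ = _ := by ring
  · push Not at hex
    rw [hcN, ofBlocks_loc_eq_zero i (R := R) (H := H) (blkSK (κ := κ) i (sIK i bI)) hex, mul_zero]
    exact mul_nonneg hK0 hloc0

/-- ★ **`hX` AT THE PRINT-WEIGHTED SITE CLASS `bHZP g s`** (`0 ≤ s ≤ 1`): the identity `bHZP g s → 𝔠_W⁽¹⁾ = cNorm (blkSK (sIK bI)) 1` has majorant `L·e^{δr}·e^{−δd}` (|c_f| = Lᵏ: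
`B9SmoothHolderClassPReadings.hasMaj_from_bHZP_of_bHZT` at `(s, 1)` + the transported reading above).
[cite: Balaban1985BackgroundPropagators, (3.41)–(3.42) p.397 + (3.44) p.398 + p.398 (remark after (3.47)); Balaban1984PropagatorsII, (2.51)–(2.54) p.232] -/
theorem hasMaj_id_bHZP_cNorm {R : ℝ} {H : Prop} {s : ℝ} (hs0 : 0 ≤ s) (hs1 : s ≤ 1)
    (hlen : ∀ y : (geo9K i).Site, 0 ≤ (geo9K i).len y) {bI : FBondY i → IBondY i}
    (hlev : ∀ f : FBondY i, lvl i.hN i.D i.hk (bI f) = (blkV1 i.hN i.D f).1.1)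
    {r δ : ℝ} (hδ : 0 ≤ δ) (hN : ∀ (y : IBondY i) (z : SiteY i), NearY i y z → (geo9K i).dist y (sIK i bI z) ≤ r)
    (hcf : |i.cf| = (nKT (toKT i) : ℝ)) :
    HasMaj (bHZP (κ := κ) i b g (R := R) (H := H) (s := s) hs0 hs1) (cNorm R H (blkSK i (sIK i bI)) hlen 1) LinearMap.id
      (fun y y' => (((ℓ + 1 : ℕ) : ℝ)) * Real.exp (δ * r) * Real.exp (-(δ * (geo9K i).dist y y'))) :=
  hasMaj_from_bHZP_of_bHZT i b g hcf hs0 hs1 (fun _ _ => by positivity)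
    (hasMaj_id_bHZT_cNorm i b g hs0 hs1 hs1 le_rfl hlen hlev hδ hN hcf.le)

/-- ★★ **`hX` OUT OF THE GRADED PRINT-WEIGHTED SITE PIN `bHZPG g w`** at any exponent `0 < s < 1` with `0 < w s`: constant `(w s)⁻¹·L·e^{δr}` — the reading
`id : bH13 x U → 𝔠_W⁽¹⁾` of the N06 certificate's (P2′) pin (only the weighted SUP part of the Hölder size is read: *"(‖λ‖ + |λ|)"*).
[cite: Balaban1985BackgroundPropagators, (3.41)–(3.42) p.397 + (3.43)–(3.45) p.398; Balaban1984PropagatorsII, (2.51)–(2.54) p.232] -/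
theorem hasMaj_id_bHZPG_cNorm {R : ℝ} {H : Prop} (w : ℝ → ℝ) (hw0 : ∀ s, 0 ≤ w s) (hw1 : ∀ s, w s ≤ 1)
    {s : ℝ} (hs0 : 0 < s) (hs1 : s < 1) (hws : 0 < w s)
    (hlen : ∀ y : (geo9K i).Site, 0 ≤ (geo9K i).len y) {bI : FBondY i → IBondY i}
    (hlev : ∀ f : FBondY i, lvl i.hN i.D i.hk (bI f) = (blkV1 i.hN i.D f).1.1)
    {r δ : ℝ} (hδ : 0 ≤ δ) (hN : ∀ (y : IBondY i) (z : SiteY i), NearY i y z → (geo9K i).dist y (sIK i bI z) ≤ r)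
    (hcf : |i.cf| = (nKT (toKT i) : ℝ)) :
    HasMaj (bHZPG (κ := κ) i b g (R := R) (H := H) w hw0 hw1) (cNorm R H (blkSK i (sIK i bI)) hlen 1) LinearMap.id
      (fun y y' => (w s)⁻¹ * ((((ℓ + 1 : ℕ) : ℝ)) * Real.exp (δ * r) * Real.exp (-(δ * (geo9K i).dist y y')))) :=
  hasMaj_from_bHZPG i b g w hw0 hw1 hs0 hs1 hws (fun _ _ => by positivity)
    (hasMaj_id_bHZP_cNorm i b g hs0.le hs1.le hlen hlev hδ hN hcf)

end Literature.MathematicalPhysics.QuantumFieldTheory.Balaban1983to89.B9SmoothHolderClassPReadingsSite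

end
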